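import Mathlib
import Summits.NavierStokesRegularity.NavierStokesRegularity.Theorems.L3TimeExponentPincerSubparabolicMorreyJaw
import Summits.NavierStokesRegularity.NavierStokesRegularity.Theorems.L3TimeExponentPincerDissipationAxis
import HarnessLib.Audit
import HarnessLib

/-!
# The sub-parabolic scaled-energy RATE governs the jaw exponent: `β ↦ 6/(1+β)`
# (route `L3TimeExponentPincer`, parent crux `L3CascadeJaw` stmt-NavierStokesRegularity-19499; support file 11 of
# seat p4 — the time-dependent form of THEOREM J‴)

Support file (cell ns-regularity-ideate, seat p4, gen 5).  0 `sorry`; one definition (the rate predicate).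

THEOREM J″ (`…JawMorreyRateHolds`, nsreg-p2 / p4 g4) and the coupled clock (`…DissipationAxis.jaw_of_coupledMorreyDissip`,
nsreg-p2 ROUND-10) read the jaw exponent off a Morrey-rate majorant `Φ(t) ≥ sup_{x₀, r<r₁} r⁻¹∫_{B(x₀,r)}|u(t)|²`
over ALL radii below `r₁`.  THEOREM J‴ (support file 10) showed that for the constant-rate case only the radii
`r ≤ √(T-t)` matter.  This file is the time-dependent version: with the **sub-parabolic rate**

  `SubparabolicMorreyRateNear u T Φ`:  `∫_{B(x₀,r)}|u(t)|² ≤ Φ(t) r` for late `t`, all `x₀`, all `0 < r ≤ √(T-t)`,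

* `l3cube_sq_le_of_subparabolicMorreyRate` — pointwise
  `‖u(t)‖₃⁶ ≤ K₁ (Φ(t)+1) δ(t) + K₂ (Φ(t)+1)/(T-t)` (`δ = dissipRate`, `K₁, K₂ < ∞` explicit in `E(u₀)`);
* `jaw_of_coupledSubparabolic` — **the sub-parabolic coupled clock**: for `Φ` measurable and `0 ≤ q < 6`,
  `∫ (Φδ)^{q/6} < ∞` and `∫ (Φ/(T-t))^{q/6} < ∞` give `∫_{T₂}^{T}‖u‖₃^q < ∞` (the second, gradient-free clock
  `Φ/(T-t)` is the price of the missing radii `> √(T-t)`);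
* `jaw_of_subparabolicMorreyPowerRate` — **power rates**: `∫_{B(x₀,r)}|u(t)|² ≤ M (T-t)^{-β} r` for `r ≤ √(T-t)`
  gives every `0 < q` with `q(1+β) < 6` (Young on `(Φδ)^{q/6}`; both clocks integrable iff `q < 6/(1+β)`) — the
  same exchange rate `β ↦ 6/(1+β)` as J″'s `jaw_of_morreyPowerRate_holds`, from the bottom radii alone;
  `l3CascadeJaw_clause_of_subparabolicMorreyPowerRate` — **`β ≤ 1/5` pays the whole `L3CascadeJaw` clause**;
* hierarchy: `subparabolicMorreyRateNear_of_morreyRateNear` (J″'s hypothesis ⇒ this one),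
  `subparabolicMorreyRateNear_const_of_subparabolic` / `subparabolicMorreyNear_of_rate_const` (J‴'s class = constant rate).

So on the Morrey side the parent crux reads: **sub-parabolic scaled energies growing no faster than
`(T-t)^{-1/5}` ⇒ the clause** (Tao's Euler-speed cascade has exactly `β = 1/5` at `r = √(T-t)`: the energy
`E` sits at scale `ℓ ≍ (T-t)^{2/5}`, so `E_r/r ≍ E r²/ℓ³ = E (T-t)^{-1/5}` at `r = √(T-t)`).
WHAT THIS IS NOT: not a claim about Navier–Stokes regularity; no rate is asserted for actual blow-ups; no item or
stub is closed.
-/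

noncomputable section

namespace Summit.NavierStokesRegularity.NavierStokesRegularity.Theorems.L3TimeExponentPincerSubparabolicMorreyRate

open MeasureTheory Set Function Filter Metric Topology
open scoped ENNReal NNReal
open Literature.Analysis.FluidPDE
open Summit.NavierStokesRegularity.NavierStokesRegularity.Theorems.L3TimeExponentPincerMorreyGrowth (V₁ V₁_nonneg)
open Summit.NavierStokesRegularity.NavierStokesRegularity.Theorems.L3TimeExponentPincerJawFullMorrey
  (dissipRate dissip_lt_top eLpNorm_three_rpow_eq)
open Summit.NavierStokesRegularity.NavierStokesRegularity.Theorems.L3TimeExponentPincerJawMorreyRate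
  (MorreyRateNear lintegral_Ioo_rpow_neg_lt_top div_ofReal_le_self)
open Summit.NavierStokesRegularity.NavierStokesRegularity.Theorems.L3TimeExponentPincerMorreyInterpolationBelow
  (lintegral_cube_sq_le_of_morreyBelow)
open Summit.NavierStokesRegularity.NavierStokesRegularity.Theorems.L3TimeExponentPincerSubparabolicMorreyJaw
  (SubparabolicMorreyNear)
open Summit.NavierStokesRegularity.NavierStokesRegularity.Theorems.L3TimeExponentPincerDissipationAxis
  (aemeasurable_dissipRate add_rpow_le_two_rpow)

/-! ## §1  The sub-parabolic Morrey rate and the hierarchy -/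

/-- **Sub-parabolic Morrey RATE near `T`**: `∫_{B(x₀,r)} |u(t)|² ≤ Φ(t) r` for all late `t`, all centres and all
sub-parabolic radii `0 < r ≤ √(T-t)` (the radii-`≤ √(T-t)` restriction of `…JawMorreyRate.MorreyRateNear`). -/
def SubparabolicMorreyRateNear (u : ℝ → (EuclideanSpace ℝ (Fin 3)) → (EuclideanSpace ℝ (Fin 3))) (T : ℝ)
    (Φ : ℝ → ℝ≥0) : Prop :=
  ∃ T₁ < T, ∀ t ∈ Ioo T₁ T, ∀ x₀ : EuclideanSpace ℝ (Fin 3), ∀ r : ℝ, 0 < r → r ^ 2 ≤ T - t →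
    ∫⁻ x in ball x₀ r, ‖u t x‖ₑ ^ 2 ≤ ENNReal.ofReal ((Φ t : ℝ) * r)

/-- J″'s all-radii Morrey rate ⇒ the sub-parabolic rate (shrink the window until `√(T-t) < r₁`). -/
theorem subparabolicMorreyRateNear_of_morreyRateNear
    {u : ℝ → (EuclideanSpace ℝ (Fin 3)) → (EuclideanSpace ℝ (Fin 3))} {T : ℝ} {Φ : ℝ → ℝ≥0}
    (h : MorreyRateNear u T Φ) : SubparabolicMorreyRateNear u T Φ := by
  obtain ⟨r₁, hr₁, T₁, hT₁, hMor⟩ := h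
  refine ⟨max T₁ (T - r₁ ^ 2), max_lt hT₁ (by nlinarith), fun t ht x₀ r hr hrs => ?_⟩
  have ht1 : T₁ < t := lt_of_le_of_lt (le_max_left _ _) ht.1
  have ht2 : T - r₁ ^ 2 < t := lt_of_le_of_lt (le_max_right _ _) ht.1
  have hrr : r < r₁ := by
    by_contra hle
    rw [not_lt] at hle
    nlinarith [pow_le_pow_left₀ hr₁.le hle 2]
  exact hMor t ⟨ht1, ht.2⟩ x₀ r hr hrr

/-- J‴'s class is the constant-rate case. -/
theorem subparabolicMorreyRateNear_const_of_subparabolic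
    {u : ℝ → (EuclideanSpace ℝ (Fin 3)) → (EuclideanSpace ℝ (Fin 3))} {T : ℝ}
    (h : SubparabolicMorreyNear u T) : ∃ M : ℝ≥0, SubparabolicMorreyRateNear u T (fun _ => M) := by
  obtain ⟨M, hM, T₁, hT₁, hMor⟩ := h
  refine ⟨M.toNNReal, T₁, hT₁, fun t ht x₀ r hr hrs => (hMor t ht x₀ r hr hrs).trans (le_of_eq ?_)⟩
  rw [Real.coe_toNNReal _ hM.le]

/-- … and conversely. -/
theorem subparabolicMorreyNear_of_rate_const
    {u : ℝ → (EuclideanSpace ℝ (Fin 3)) → (EuclideanSpace ℝ (Fin 3))} {T : ℝ} {M : ℝ≥0}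
    (h : SubparabolicMorreyRateNear u T (fun _ => M)) : SubparabolicMorreyNear u T := by
  obtain ⟨T₁, hT₁, hMor⟩ := h
  refine ⟨(M : ℝ) + 1, by positivity, T₁, hT₁, fun t ht x₀ r hr hrs => (hMor t ht x₀ r hr hrs).trans ?_⟩
  exact ENNReal.ofReal_le_ofReal (by nlinarith [M.coe_nonneg])

/-! ## §2  The pointwise bound `‖u(t)‖₃⁶ ≤ K₁ (Φ+1) δ + K₂ (Φ+1)/(T-t)` -/

/-- **Pointwise slice bound under a sub-parabolic rate**: for a classical solution on `[0,T)`, Leray–Hopf from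
`u 0`, with `SubparabolicMorreyRateNear u T Φ`, there are `T₂ ∈ (0,T)` and finite `K₁, K₂` with
`(∫|u(t)|³)² ≤ K₁ (Φ(t)+1) δ(t) + K₂ (Φ(t)+1) (T-t)⁻¹` for all `t ∈ (T₂,T)` (support file 9 with `M₂ = 2(Φ(t)+1)`,
`ρ⋆ = √(T-t)/2`; `K₁ = (1152/V₁) E`, `K₂ = 1152 E²/V₁`, `E = 2·kineticEnergy(u 0)`). -/
theorem l3cube_sq_le_of_subparabolicMorreyRate {ν T : ℝ} (hν : 0 < ν) (hT : 0 < T)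
    {u : ℝ → (EuclideanSpace ℝ (Fin 3)) → (EuclideanSpace ℝ (Fin 3))} {p : ℝ → (EuclideanSpace ℝ (Fin 3)) → ℝ}
    (hcl : IsClassicalNSSolutionOn (Ico 0 T) ν 0 u p) (hLH : IsLerayHopfOn T ν 0 (u 0) u)
    {Φ : ℝ → ℝ≥0} (hS : SubparabolicMorreyRateNear u T Φ) :
    ∃ T₂ ∈ Ioo 0 T, ∃ K₁ : ℝ≥0∞, K₁ ≠ ⊤ ∧ ∃ K₂ : ℝ≥0∞, K₂ ≠ ⊤ ∧ ∀ t ∈ Ioo T₂ T,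
      (∫⁻ y, ‖u t y‖ₑ ^ (3 : ℕ)) ^ 2 ≤
        K₁ * ((Φ t : ℝ≥0∞) + 1) * dissipRate u t + K₂ * ((Φ t : ℝ≥0∞) + 1) * ENNReal.ofReal ((T - t)⁻¹) := by
  have hV : 0 < V₁ := by
    rw [V₁]
    exact ENNReal.toReal_pos (measure_ball_pos volume (0 : EuclideanSpace ℝ (Fin 3)) one_pos).ne'
      measure_ball_lt_top.ne
  obtain ⟨T₁, hT₁, hMor⟩ := hS
  set e₀ : ℝ := 2 * VectorCalculus.kineticEnergy (u 0) with he₀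
  have he₀nn : 0 ≤ e₀ := mul_nonneg zero_le_two (kineticEnergy_nonneg _)
  set T₂ : ℝ := max T₁ (T / 2) with hT₂
  have hT₂mem : T₂ ∈ Ioo 0 T := ⟨lt_max_of_lt_right (by linarith), max_lt hT₁ (by linarith)⟩
  refine ⟨T₂, hT₂mem, ENNReal.ofReal (1152 / V₁) * ENNReal.ofReal e₀,
    ENNReal.mul_ne_top ENNReal.ofReal_ne_top ENNReal.ofReal_ne_top,
    ENNReal.ofReal (1152 * e₀ ^ 2 / V₁), ENNReal.ofReal_ne_top, fun t ht => ?_⟩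
  have htT₁ : T₁ < t := lt_of_le_of_lt (le_max_left _ _) ht.1
  have ht0 : 0 < t := hT₂mem.1.trans ht.1
  have htc : t ∈ Ico 0 T := ⟨ht0.le, ht.2⟩
  have hs : 0 < T - t := sub_pos.2 ht.2
  set ρs : ℝ := Real.sqrt (T - t) / 2 with hρs
  have hρs0 : 0 < ρs := by positivity
  have hΦnn : 0 ≤ (Φ t : ℝ) := (Φ t).coe_nonneg
  set M₂ : ℝ := 2 * ((Φ t : ℝ) + 1) with hM₂
  have hM₂pos : 0 < M₂ := by positivity
  have hE : ∫⁻ y, ‖u t y‖ₑ ^ 2 ≤ ENNReal.ofReal e₀ := hLH.lintegral_enorm_sq_le hν.le ⟨ht0.le, ht.2.le⟩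
  have hf : ContDiff ℝ 1 (u t) := (hcl.contDiff_velocity htc).of_le (by exact_mod_cast le_top)
  have hMor' : ∀ (x₀ : EuclideanSpace ℝ (Fin 3)) (ρ : ℝ), 0 < ρ → ρ ≤ ρs →
      ∫⁻ y in closedBall x₀ ρ, ‖u t y‖ₑ ^ 2 ≤ ENNReal.ofReal (M₂ * ρ) := by
    intro x₀ ρ hρ hρle
    have h2ρ : (2 * ρ) ^ 2 ≤ T - t := by
      have h1 : 2 * ρ ≤ Real.sqrt (T - t) := by rw [hρs] at hρle; linarith
      calc (2 * ρ) ^ 2 ≤ Real.sqrt (T - t) ^ 2 := pow_le_pow_left₀ (by positivity) h1 2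
        _ = T - t := Real.sq_sqrt hs.le
    calc ∫⁻ y in closedBall x₀ ρ, ‖u t y‖ₑ ^ 2 ≤ ∫⁻ y in ball x₀ (2 * ρ), ‖u t y‖ₑ ^ 2 :=
          lintegral_mono_set (closedBall_subset_ball (by linarith))
      _ ≤ ENNReal.ofReal ((Φ t : ℝ) * (2 * ρ)) := hMor t ⟨htT₁, ht.2⟩ x₀ (2 * ρ) (by positivity) h2ρ
      _ ≤ ENNReal.ofReal (M₂ * ρ) := ENNReal.ofReal_le_ofReal (by rw [hM₂]; nlinarith)
  have h1 := lintegral_cube_sq_le_of_morreyBelow hf hM₂pos hρs0 hMor'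
    (ne_top_of_le_ne_top ENNReal.ofReal_ne_top hE)
  have hD : ∫⁻ y, ‖fderiv ℝ (u t) y‖ₑ ^ 2 ≤ dissipRate u t := by
    change ∫⁻ y, ‖fderiv ℝ (u t) y‖ₑ ^ 2 ≤ ∫⁻ y, ENNReal.ofReal (frobeniusNormSq (fderiv ℝ (u t) y))
    refine lintegral_mono fun y => ?_
    rw [← ofReal_norm, ← ENNReal.ofReal_pow (norm_nonneg _)]
    exact ENNReal.ofReal_le_ofReal (sq_opNorm_le_frobeniusNormSq _)
  have hφ1 : ((Φ t : ℝ≥0∞) + 1) = ENNReal.ofReal ((Φ t : ℝ) + 1) := by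
    rw [ENNReal.ofReal_add hΦnn zero_le_one, ENNReal.ofReal_coe_nnreal, ENNReal.ofReal_one]
  have hc1 : ENNReal.ofReal (576 * M₂ / V₁) = ENNReal.ofReal (1152 / V₁) * ((Φ t : ℝ≥0∞) + 1) := by
    rw [hφ1, ← ENNReal.ofReal_mul (by positivity), hM₂]
    congr 1
    field_simp
    ring
  have hc2 : ENNReal.ofReal (144 * M₂ / (V₁ * ρs ^ 2)) * (ENNReal.ofReal e₀) ^ 2 =
      ENNReal.ofReal (1152 * e₀ ^ 2 / V₁) * ((Φ t : ℝ≥0∞) + 1) * ENNReal.ofReal ((T - t)⁻¹) := by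
    have hρs2 : ρs ^ 2 = (T - t) / 4 := by rw [hρs, div_pow, Real.sq_sqrt hs.le]; ring
    rw [hφ1, ← ENNReal.ofReal_pow he₀nn, ← ENNReal.ofReal_mul (by positivity),
      ← ENNReal.ofReal_mul (by positivity), ← ENNReal.ofReal_mul (by positivity), hρs2, hM₂]
    congr 1
    field_simp
    ring
  calc (∫⁻ y, ‖u t y‖ₑ ^ (3 : ℕ)) ^ 2
      ≤ ENNReal.ofReal (576 * M₂ / V₁) * (∫⁻ y, ‖u t y‖ₑ ^ 2) * (∫⁻ y, ‖fderiv ℝ (u t) y‖ₑ ^ 2) +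
          ENNReal.ofReal (144 * M₂ / (V₁ * ρs ^ 2)) * (∫⁻ y, ‖u t y‖ₑ ^ 2) ^ 2 := h1
    _ ≤ ENNReal.ofReal (576 * M₂ / V₁) * ENNReal.ofReal e₀ * dissipRate u t +
          ENNReal.ofReal (144 * M₂ / (V₁ * ρs ^ 2)) * (ENNReal.ofReal e₀) ^ 2 := by gcongr
    _ = ENNReal.ofReal (1152 / V₁) * ENNReal.ofReal e₀ * ((Φ t : ℝ≥0∞) + 1) * dissipRate u t +
          ENNReal.ofReal (1152 * e₀ ^ 2 / V₁) * ((Φ t : ℝ≥0∞) + 1) * ENNReal.ofReal ((T - t)⁻¹) := by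
        rw [hc1, hc2]; ring

/-! ## §3  The sub-parabolic coupled clock -/

/-- **The sub-parabolic coupled clock.**  For a classical solution on `[0,T)`, Leray–Hopf from `u 0`, a
measurable sub-parabolic rate `Φ` (`SubparabolicMorreyRateNear u T Φ`) and `0 ≤ q < 6`: if both clocks are
integrable near `T`, `∫ (Φ(t) δ(t))^{q/6} dt < ∞` and `∫ (Φ(t)/(T-t))^{q/6} dt < ∞`, then
`∫_{T₂}^{T} ‖u(t)‖₃^q dt < ∞`.  (`…DissipationAxis.jaw_of_coupledMorreyDissip` asks the first clock with the
all-radii rate; here the rate sees only `r ≤ √(T-t)` and the second, gradient-free clock pays for the rest.) -/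
theorem jaw_of_coupledSubparabolic {ν T : ℝ} (hν : 0 < ν) (hT : 0 < T)
    {u : ℝ → (EuclideanSpace ℝ (Fin 3)) → (EuclideanSpace ℝ (Fin 3))} {p : ℝ → (EuclideanSpace ℝ (Fin 3)) → ℝ}
    (hcl : IsClassicalNSSolutionOn (Ico 0 T) ν 0 u p) (hLH : IsLerayHopfOn T ν 0 (u 0) u)
    {Φ : ℝ → ℝ≥0} (hΦm : Measurable Φ) (hS : SubparabolicMorreyRateNear u T Φ)
    {q : ℝ} (hq0 : 0 ≤ q) (hq6 : q < 6)
    (hint₁ : ∃ T₁' < T, ∫⁻ t in Ioo T₁' T, ((Φ t : ℝ≥0∞) * dissipRate u t) ^ (q / 6) < ⊤)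
    (hint₂ : ∃ T₁'' < T, ∫⁻ t in Ioo T₁'' T, ((Φ t : ℝ≥0∞) * ENNReal.ofReal ((T - t)⁻¹)) ^ (q / 6) < ⊤) :
    ∃ T₂ ∈ Ioo 0 T, (∫⁻ t in Ioo T₂ T, eLpNorm (u t) 3 volume ^ q) < ⊤ := by
  obtain ⟨T₂, hT₂, K₁, hK₁, K₂, hK₂, hpt⟩ := l3cube_sq_le_of_subparabolicMorreyRate hν hT hcl hLH hS
  obtain ⟨T₁', hT₁', hint₁⟩ := hint₁
  obtain ⟨T₁'', hT₁'', hint₂⟩ := hint₂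
  set a : ℝ := q / 6 with ha
  have ha0 : 0 ≤ a := by positivity
  have ha1 : a ≤ 1 := by rw [ha]; linarith
  have ha1' : a < 1 := by rw [ha]; linarith
  set T₃ : ℝ := max (max T₁' T₁'') T₂ with hT₃
  have hT₃mem : T₃ ∈ Ioo 0 T := ⟨lt_max_of_lt_right hT₂.1, max_lt (max_lt hT₁' hT₁'') hT₂.2⟩
  set L₁ : ℝ≥0∞ := K₁ ^ a * (2 : ℝ≥0∞) ^ a with hL₁
  set L₂ : ℝ≥0∞ := K₂ ^ a * (2 : ℝ≥0∞) ^ a with hL₂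
  have hL₁top : L₁ ≠ ⊤ :=
    ENNReal.mul_ne_top (ENNReal.rpow_ne_top_of_nonneg ha0 hK₁) (ENNReal.rpow_ne_top_of_nonneg ha0 (by norm_num))
  have hL₂top : L₂ ≠ ⊤ :=
    ENNReal.mul_ne_top (ENNReal.rpow_ne_top_of_nonneg ha0 hK₂) (ENNReal.rpow_ne_top_of_nonneg ha0 (by norm_num))
  -- pointwise bound
  have hbound : ∀ t ∈ Ioo T₃ T, eLpNorm (u t) 3 volume ^ q ≤
      L₁ * (((Φ t : ℝ≥0∞) * dissipRate u t) ^ a + (dissipRate u t + 1)) +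
        L₂ * (((Φ t : ℝ≥0∞) * ENNReal.ofReal ((T - t)⁻¹)) ^ a + ENNReal.ofReal ((T - t) ^ (-a))) := by
    intro t ht
    have ht₂ : t ∈ Ioo T₂ T := ⟨lt_of_le_of_lt (le_max_right _ _) ht.1, ht.2⟩
    have hs : 0 < T - t := sub_pos.2 ht.2
    have h1 : eLpNorm (u t) 3 volume ^ q = ((∫⁻ y, ‖u t y‖ₑ ^ (3 : ℕ)) ^ 2) ^ a := by
      rw [eLpNorm_three_rpow_eq, ← ENNReal.rpow_two, ← ENNReal.rpow_mul]
      congr 1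
      rw [ha]; ring
    have hδ : (dissipRate u t) ^ a ≤ dissipRate u t + 1 := by
      rcases le_total (dissipRate u t) 1 with hx | hx
      · exact (ENNReal.rpow_le_one hx ha0).trans le_add_self
      · exact ((ENNReal.rpow_le_rpow_of_exponent_le hx ha1).trans_eq (ENNReal.rpow_one _)).trans le_self_add
    have hsa : (ENNReal.ofReal ((T - t)⁻¹)) ^ a = ENNReal.ofReal ((T - t) ^ (-a)) := by
      rw [ENNReal.ofReal_rpow_of_nonneg (inv_nonneg.2 hs.le) ha0, Real.inv_rpow hs.le, Real.rpow_neg hs.le]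
    rw [h1]
    calc ((∫⁻ y, ‖u t y‖ₑ ^ (3 : ℕ)) ^ 2) ^ a
        ≤ (K₁ * ((Φ t : ℝ≥0∞) + 1) * dissipRate u t +
            K₂ * ((Φ t : ℝ≥0∞) + 1) * ENNReal.ofReal ((T - t)⁻¹)) ^ a := ENNReal.rpow_le_rpow (hpt t ht₂) ha0
      _ ≤ (K₁ * ((Φ t : ℝ≥0∞) + 1) * dissipRate u t) ^ a +
            (K₂ * ((Φ t : ℝ≥0∞) + 1) * ENNReal.ofReal ((T - t)⁻¹)) ^ a :=
          ENNReal.rpow_add_le_add_rpow _ _ ha0 ha1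
      _ = K₁ ^ a * ((((Φ t : ℝ≥0∞) + 1)) * dissipRate u t) ^ a +
            K₂ ^ a * ((((Φ t : ℝ≥0∞) + 1)) * ENNReal.ofReal ((T - t)⁻¹)) ^ a := by
          rw [mul_assoc K₁, mul_assoc K₂, ENNReal.mul_rpow_of_nonneg _ _ ha0, ENNReal.mul_rpow_of_nonneg K₂ _ ha0]
      _ ≤ K₁ ^ a * ((2 : ℝ≥0∞) ^ a * ((((Φ t : ℝ≥0∞)) * dissipRate u t) ^ a + (dissipRate u t) ^ a)) +
            K₂ ^ a * ((2 : ℝ≥0∞) ^ a *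
              ((((Φ t : ℝ≥0∞)) * ENNReal.ofReal ((T - t)⁻¹)) ^ a + (ENNReal.ofReal ((T - t)⁻¹)) ^ a)) := by
          gcongr
          · rw [add_mul, one_mul]
            exact add_rpow_le_two_rpow _ _ ha0
          · rw [add_mul, one_mul]
            exact add_rpow_le_two_rpow _ _ ha0
      _ ≤ L₁ * (((Φ t : ℝ≥0∞) * dissipRate u t) ^ a + (dissipRate u t + 1)) +
            L₂ * (((Φ t : ℝ≥0∞) * ENNReal.ofReal ((T - t)⁻¹)) ^ a + ENNReal.ofReal ((T - t) ^ (-a))) := by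
          rw [hL₁, hL₂, mul_assoc, mul_assoc, ← hsa]
          gcongr
  -- integrate
  refine ⟨T₃, hT₃mem, ?_⟩
  have hdiss : ∫⁻ t in Ioo T₃ T, dissipRate u t < ⊤ :=
    lt_of_le_of_lt (lintegral_mono_set (Ioo_subset_Ioo_left hT₃mem.1.le)) (dissip_lt_top hcl hLH)
  have hδm : AEMeasurable (fun t => dissipRate u t + 1) ((volume : Measure ℝ).restrict (Ioo T₃ T)) :=
    ((aemeasurable_dissipRate hcl).mono_set (Ioo_subset_Ioo_left hT₃mem.1.le)).add_const 1
  have hm2a : Measurable fun t : ℝ => ((Φ t : ℝ≥0∞) * ENNReal.ofReal ((T - t)⁻¹)) ^ a :=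
    (hΦm.coe_nnreal_ennreal.mul ((measurable_const.sub measurable_id).inv.ennreal_ofReal)).pow_const a
  have hm2b : Measurable fun t : ℝ => ENNReal.ofReal ((T - t) ^ (-a)) :=
    ((measurable_const.sub measurable_id).pow_const _).ennreal_ofReal
  have hm2 : Measurable fun t : ℝ =>
      L₂ * (((Φ t : ℝ≥0∞) * ENNReal.ofReal ((T - t)⁻¹)) ^ a + ENNReal.ofReal ((T - t) ^ (-a))) :=
    (hm2a.add hm2b).const_mul L₂
  have hI1 : ∫⁻ t in Ioo T₃ T, L₁ * (((Φ t : ℝ≥0∞) * dissipRate u t) ^ a + (dissipRate u t + 1)) < ⊤ := by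
    rw [lintegral_const_mul' _ _ hL₁top, lintegral_add_right' _ hδm, lintegral_add_right _ measurable_const]
    refine ENNReal.mul_lt_top hL₁top.lt_top (ENNReal.add_lt_top.2 ⟨?_, ENNReal.add_lt_top.2 ⟨hdiss, ?_⟩⟩)
    · exact lt_of_le_of_lt (lintegral_mono_set (Ioo_subset_Ioo_left
        ((le_max_left _ _).trans (le_max_left _ _)))) hint₁
    · rw [setLIntegral_const, Real.volume_Ioo]
      exact ENNReal.mul_lt_top ENNReal.one_lt_top ENNReal.ofReal_lt_top
  have hI2 : ∫⁻ t in Ioo T₃ T,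
      L₂ * (((Φ t : ℝ≥0∞) * ENNReal.ofReal ((T - t)⁻¹)) ^ a + ENNReal.ofReal ((T - t) ^ (-a))) < ⊤ := by
    rw [lintegral_const_mul' _ _ hL₂top, lintegral_add_right _ hm2b]
    refine ENNReal.mul_lt_top hL₂top.lt_top (ENNReal.add_lt_top.2 ⟨?_, ?_⟩)
    · exact lt_of_le_of_lt (lintegral_mono_set (Ioo_subset_Ioo_left
        ((le_max_right _ _).trans (le_max_left _ _)))) hint₂
    · have h := lintegral_Ioo_rpow_neg_lt_top (k := 1) hT₃mem.2 ha1'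
      simpa only [one_mul] using h
  calc ∫⁻ t in Ioo T₃ T, eLpNorm (u t) 3 volume ^ q
      ≤ ∫⁻ t in Ioo T₃ T, (L₁ * (((Φ t : ℝ≥0∞) * dissipRate u t) ^ a + (dissipRate u t + 1)) +
          L₂ * (((Φ t : ℝ≥0∞) * ENNReal.ofReal ((T - t)⁻¹)) ^ a + ENNReal.ofReal ((T - t) ^ (-a)))) :=
        setLIntegral_mono' measurableSet_Ioo hbound
    _ = (∫⁻ t in Ioo T₃ T, L₁ * (((Φ t : ℝ≥0∞) * dissipRate u t) ^ a + (dissipRate u t + 1))) +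
          ∫⁻ t in Ioo T₃ T,
            L₂ * (((Φ t : ℝ≥0∞) * ENNReal.ofReal ((T - t)⁻¹)) ^ a + ENNReal.ofReal ((T - t) ^ (-a))) :=
        lintegral_add_right _ hm2
    _ < ⊤ := ENNReal.add_lt_top.2 ⟨hI1, hI2⟩

/-! ## §4  Power rates: `β ↦ 6/(1+β)` from the bottom radii alone -/

/-- **Sub-parabolic power rate ⇒ the jaw for every `q < 6/(1+β)`.**  For a classical solution on `[0,T)`,
Leray–Hopf from `u 0`: if `∫_{B(x₀,r)} |u(t)|² ≤ M (T-t)^{-β} r` for all late `t`, all `x₀` and all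
`0 < r ≤ √(T-t)` (`M, β ≥ 0`), then `∫_{T₂}^{T} ‖u(t)‖₃^q dt < ∞` for every `0 < q` with `q (1+β) < 6`.
(Clock 1 by Young: `(Φδ)^{q/6} ≤ Φ^{q/(6-q)} + δ` with `Φ^{q/(6-q)} ≍ (T-t)^{-βq/(6-q)}`; clock 2:
`(Φ/(T-t))^{q/6} ≍ (T-t)^{-(1+β)q/6}`; both integrable iff `q(1+β) < 6`.) -/
theorem jaw_of_subparabolicMorreyPowerRate {ν T : ℝ} (hν : 0 < ν) (hT : 0 < T)
    {u : ℝ → (EuclideanSpace ℝ (Fin 3)) → (EuclideanSpace ℝ (Fin 3))} {p : ℝ → (EuclideanSpace ℝ (Fin 3)) → ℝ}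
    (hcl : IsClassicalNSSolutionOn (Ico 0 T) ν 0 u p) (hLH : IsLerayHopfOn T ν 0 (u 0) u)
    {M β : ℝ} (hM : 0 ≤ M) (hβ : 0 ≤ β)
    (hrate : ∃ T₁ < T, ∀ t ∈ Ioo T₁ T, ∀ x₀ : EuclideanSpace ℝ (Fin 3), ∀ r : ℝ, 0 < r → r ^ 2 ≤ T - t →
      ∫⁻ x in ball x₀ r, ‖u t x‖ₑ ^ 2 ≤ ENNReal.ofReal (M * (T - t) ^ (-β) * r))
    {q : ℝ} (hq0 : 0 < q) (hqβ : q * (1 + β) < 6) :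
    ∃ T₂ ∈ Ioo 0 T, (∫⁻ t in Ioo T₂ T, eLpNorm (u t) 3 volume ^ q) < ⊤ := by
  obtain ⟨T₁, hT₁, hrate⟩ := hrate
  have hq6 : q < 6 := by nlinarith
  -- the rate function
  set Φ : ℝ → ℝ≥0 := fun t => (M * (T - t) ^ (-β)).toNNReal with hΦ
  have hΦm : Measurable Φ :=
    (measurable_const.mul ((measurable_const.sub measurable_id).pow_const _)).real_toNNReal
  have hΦeq : ∀ t, t < T → (Φ t : ℝ) = M * (T - t) ^ (-β) := fun t ht =>
    Real.coe_toNNReal _ (mul_nonneg hM (Real.rpow_nonneg (sub_pos.2 ht).le _))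
  have hS : SubparabolicMorreyRateNear u T Φ :=
    ⟨T₁, hT₁, fun t ht x₀ r hr hrs => by rw [hΦeq t ht.2]; exact hrate t ht x₀ r hr hrs⟩
  have ha0 : 0 < q / 6 := by positivity
  -- clock 1: Young
  have hα : 0 < (6 - q) / 6 := by linarith
  have hconj : (1 / ((6 - q) / 6)).HolderConjugate (1 / (q / 6)) :=
    Real.holderConjugate_one_div hα ha0 (by ring)
  have hp1 : 1 ≤ 1 / ((6 - q) / 6) := one_le_one_div hα (by linarith)
  have hp2 : 1 ≤ 1 / (q / 6) := one_le_one_div ha0 (by linarith)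
  set γ₁ : ℝ := β * (q / (6 - q)) with hγ₁
  have hγ₁1 : γ₁ < 1 := by
    rw [hγ₁, ← mul_div_assoc, div_lt_one (by linarith)]
    nlinarith
  have hclock1 : ∃ T₁' < T, ∫⁻ t in Ioo T₁' T, ((Φ t : ℝ≥0∞) * dissipRate u t) ^ (q / 6) < ⊤ := by
    refine ⟨max T₁ 0, max_lt hT₁ hT, ?_⟩
    have hpt : ∀ t ∈ Ioo (max T₁ 0) T, ((Φ t : ℝ≥0∞) * dissipRate u t) ^ (q / 6) ≤
        ENNReal.ofReal (M ^ (q / (6 - q)) * (T - t) ^ (-γ₁)) + dissipRate u t := by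
      intro t ht
      have hs : 0 < T - t := sub_pos.2 ht.2
      rw [ENNReal.mul_rpow_of_nonneg _ _ ha0.le]
      have hY := ENNReal.young_inequality ((Φ t : ℝ≥0∞) ^ (q / 6)) ((dissipRate u t) ^ (q / 6)) hconj
      have hA : (((Φ t : ℝ≥0∞) ^ (q / 6)) ^ (1 / ((6 - q) / 6))) =
          ENNReal.ofReal (M ^ (q / (6 - q)) * (T - t) ^ (-γ₁)) := by
        rw [← ENNReal.rpow_mul, show q / 6 * (1 / ((6 - q) / 6)) = q / (6 - q) by field_simp,
          ← ENNReal.ofReal_coe_nnreal, hΦeq t ht.2,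
          ENNReal.ofReal_rpow_of_nonneg (mul_nonneg hM (Real.rpow_nonneg hs.le _)) (by positivity),
          Real.mul_rpow hM (Real.rpow_nonneg hs.le _), ← Real.rpow_mul hs.le, hγ₁]
        congr 3
        ring
      have hD : ((dissipRate u t) ^ (q / 6)) ^ (1 / (q / 6)) = dissipRate u t := by
        rw [← ENNReal.rpow_mul, show q / 6 * (1 / (q / 6)) = 1 by field_simp, ENNReal.rpow_one]
      calc (Φ t : ℝ≥0∞) ^ (q / 6) * (dissipRate u t) ^ (q / 6) ≤ _ := hY
        _ ≤ ((Φ t : ℝ≥0∞) ^ (q / 6)) ^ (1 / ((6 - q) / 6)) + ((dissipRate u t) ^ (q / 6)) ^ (1 / (q / 6)) :=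
            add_le_add (div_ofReal_le_self _ hp1) (div_ofReal_le_self _ hp2)
        _ = _ := by rw [hA, hD]
    have hmeas : Measurable fun t : ℝ => ENNReal.ofReal (M ^ (q / (6 - q)) * (T - t) ^ (-γ₁)) :=
      (measurable_const.mul ((measurable_const.sub measurable_id).pow_const _)).ennreal_ofReal
    have hdiss : ∫⁻ t in Ioo (max T₁ 0) T, dissipRate u t < ⊤ :=
      lt_of_le_of_lt (lintegral_mono_set (Ioo_subset_Ioo_left (le_max_right _ _))) (dissip_lt_top hcl hLH)
    calc ∫⁻ t in Ioo (max T₁ 0) T, ((Φ t : ℝ≥0∞) * dissipRate u t) ^ (q / 6)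
        ≤ ∫⁻ t in Ioo (max T₁ 0) T, (ENNReal.ofReal (M ^ (q / (6 - q)) * (T - t) ^ (-γ₁)) + dissipRate u t) :=
          setLIntegral_mono' measurableSet_Ioo hpt
      _ = (∫⁻ t in Ioo (max T₁ 0) T, ENNReal.ofReal (M ^ (q / (6 - q)) * (T - t) ^ (-γ₁))) +
            ∫⁻ t in Ioo (max T₁ 0) T, dissipRate u t := lintegral_add_left hmeas _
      _ < ⊤ := ENNReal.add_lt_top.2 ⟨lintegral_Ioo_rpow_neg_lt_top (max_lt hT₁ hT) hγ₁1, hdiss⟩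
  -- clock 2: pure power
  set γ₂ : ℝ := (1 + β) * (q / 6) with hγ₂
  have hγ₂1 : γ₂ < 1 := by rw [hγ₂]; nlinarith
  have hclock2 : ∃ T₁'' < T, ∫⁻ t in Ioo T₁'' T,
      ((Φ t : ℝ≥0∞) * ENNReal.ofReal ((T - t)⁻¹)) ^ (q / 6) < ⊤ := by
    refine ⟨T₁, hT₁, ?_⟩
    have hpt : ∀ t ∈ Ioo T₁ T, ((Φ t : ℝ≥0∞) * ENNReal.ofReal ((T - t)⁻¹)) ^ (q / 6) =
        ENNReal.ofReal (M ^ (q / 6) * (T - t) ^ (-γ₂)) := by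
      intro t ht
      have hs : 0 < T - t := sub_pos.2 ht.2
      rw [← ENNReal.ofReal_coe_nnreal, hΦeq t ht.2, ← ENNReal.ofReal_mul (mul_nonneg hM (Real.rpow_nonneg hs.le _)),
        ENNReal.ofReal_rpow_of_nonneg (by positivity) ha0.le,
        show M * (T - t) ^ (-β) * (T - t)⁻¹ = M * ((T - t) ^ (-β) * (T - t) ^ (-1 : ℝ)) by
          rw [Real.rpow_neg_one]; ring,
        ← Real.rpow_add hs, Real.mul_rpow hM (Real.rpow_nonneg hs.le _), ← Real.rpow_mul hs.le, hγ₂]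
      congr 3
      ring
    calc ∫⁻ t in Ioo T₁ T, ((Φ t : ℝ≥0∞) * ENNReal.ofReal ((T - t)⁻¹)) ^ (q / 6)
        = ∫⁻ t in Ioo T₁ T, ENNReal.ofReal (M ^ (q / 6) * (T - t) ^ (-γ₂)) :=
          setLIntegral_congr_fun measurableSet_Ioo hpt
      _ < ⊤ := lintegral_Ioo_rpow_neg_lt_top hT₁ hγ₂1
  exact jaw_of_coupledSubparabolic hν hT hcl hLH hΦm hS hq0.le hq6 hclock1 hclock2

/-- **`β ≤ 1/5` pays the whole `L3CascadeJaw` clause from the bottom radii**: a classical solution on `[0,T)`,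
Leray–Hopf from a rapidly decaying datum, whose SUB-PARABOLIC scaled energies grow at most like `(T-t)^{-β}` with
`β ≤ 1/5` satisfies the clause of the parent crux for every `q ∈ (4,5)`. -/
theorem l3CascadeJaw_clause_of_subparabolicMorreyPowerRate (q : ℝ) (hq4 : 4 < q) (hq5 : q < 5) {ν T : ℝ}
    (hν : 0 < ν) (hT : 0 < T)
    {u : ℝ → (EuclideanSpace ℝ (Fin 3)) → (EuclideanSpace ℝ (Fin 3))} {p : ℝ → (EuclideanSpace ℝ (Fin 3)) → ℝ}
    (hcl : IsClassicalNSSolutionOn (Ico 0 T) ν 0 u p) (hLH : IsLerayHopfOn T ν 0 (u 0) u)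
    (_hdec : HasRapidSpatialDecay (u 0)) {M β : ℝ} (hM : 0 ≤ M) (hβ : 0 ≤ β) (hβ5 : β ≤ 1 / 5)
    (hrate : ∃ T₁ < T, ∀ t ∈ Ioo T₁ T, ∀ x₀ : EuclideanSpace ℝ (Fin 3), ∀ r : ℝ, 0 < r → r ^ 2 ≤ T - t →
      ∫⁻ x in ball x₀ r, ‖u t x‖ₑ ^ 2 ≤ ENNReal.ofReal (M * (T - t) ^ (-β) * r)) :
    ∃ T₂ ∈ Ioo 0 T, (∫⁻ t in Ioo T₂ T, eLpNorm (u t) 3 volume ^ q) < ⊤ :=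
  jaw_of_subparabolicMorreyPowerRate hν hT hcl hLH hM hβ hrate (by linarith) (by nlinarith)

end Summit.NavierStokesRegularity.NavierStokesRegularity.Theorems.L3TimeExponentPincerSubparabolicMorreyRate

end
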